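import Mathlib
import HarnessLib
import Summits.Ventures.LatticeQCDFlow.Scaling.PlaquetteTwoWeightConstant

/-!
# LatticeQCDFlow / Scaling — the many-plaquette constants: `∫ ∏_{i<n} w(a_i h^{±1} b_i) dHaar ≤ ∫ wⁿ dHaar`
# for ANY number of plaquettes sharing a freshly drawn link (AM–GM), with `∫ wⁿ < M^{n−1}·∫ w`

HONEST FRAMING: exact (Metropolis-corrected) sampling algorithms for lattice gauge theory;
figures of merit are autocorrelation/cost numbers at stated couplings and volumes; no
continuum-physics claim.

Venture `LatticeQCDFlow` (cell pub-lqcd), topic `Scaling`, FANOUT row 30 (lean-1, GEN-27) — OUR WORK on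
THEORY-2.md §4 row C5 (gen25 Q3 ∕ gen26 «NEXT MATHEMATICS» (4): conditioners beyond one-plaquette heat baths;
and the analytic input for sharper closing bounds).  When a link `h` of `(ℤ/L)^d` is drawn, EVERY plaquette it
closes sees `h` exactly once, as `a_i h b_i` or `a_i h⁻¹ b_i` (`PlaquetteSharedLinkPeeling` §1); the weight
to integrate is `∏_i w(a_i h^{±1} b_i)`.  `PlaquetteTwoWeightConstant` §5 bounded TWO such factors by
`∫ w²` (Cauchy–Schwarz `2xy ≤ x² + y²`).  Here ANY number `n ≥ 1` of factors, by the arithmetic–geometric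
mean inequality `∏_{i<n} x_i ≤ (1/n) Σ_i x_iⁿ` and the invariance of the Haar probability measure:

* §1 **`prod_le_sum_pow_div_card`** — AM–GM in the form `∏_{i∈s} x_i ≤ (Σ_{i∈s} x_i^{#s})/#s` for
  non-negative reals;
* §2 **`integral_prod_shiftedWeight_le`** — THE MANY-PLAQUETTE CONSTANT: for a continuous `w ≥ 0` on a compact
  group and any finite family of two-sided shifts with optional inversion,
  `∫ ∏_{i∈s} w(a_i h^{ε_i} b_i) dHaar(h) ≤ ∫ w^{#s} dHaar` (`s ≠ ∅`) — each `∫ w(a_i h^{ε_i} b_i)^{n} dHaar = ∫ wⁿ`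
  (**`integral_shiftedWeight_pow_eq`**); this is the normaliser bound `N_ℓ ≤ c_{j_ℓ} := ∫ w^{j_ℓ}` for the
  conditioner that scores ALL `j_ℓ` plaquettes closed by the link `ℓ` (README (4));
* §3 the constants `c_n = ∫ wⁿ dHaar`: `c_{n+1} ≤ M·c_n` (**`integral_pow_succ_le`**), `c_n ≤ M^{n−1}·c_1`, and
  STRICTLY `c_n < M^{n−1}·c_1` for `n ≥ 2` whenever `0 < w ≤ M` is continuous and not identically `M`
  (**`integral_pow_lt`**, from `PlaquetteTwoWeightConstant.integral_sq_div_integral_lt`): scoring `n` closing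
  plaquettes with one draw always beats the one-plaquette worst case `M^{n−1}·c` by a definite factor; the
  ratios `θ_n = c_{n+1}/(c·Mⁿ)` decrease in `n` (**`integral_pow_ratio_succ_le`**) and are all `≤ θ_1 = c_2/(c·M)`,
  the Cauchy–Schwarz two-plaquette ratio of `PlaquetteTwoWeightConstant` §5 (**`integral_pow_ratio_le_two`**).

No `def`, no `sorry`, nothing cited as a fact beyond the tree.
-/

noncomputable section

namespace Summit.Ventures.LatticeQCDFlow.Theory2.Autoregressive

open MeasureTheory Finset
open Literature.MathematicalPhysics.QuantumFieldTheory Literature.MathematicalPhysics.QuantumLattice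

/-! ## §1 AM–GM -/

/-- **AM–GM**: for non-negative reals, `∏_{i∈s} x_i ≤ (Σ_{i∈s} x_i^{#s}) / #s` (`s` non-empty). [folklore] -/
theorem prod_le_sum_pow_div_card {ι : Type*} (s : Finset ι) (hs : s.Nonempty) (x : ι → ℝ)
    (hx : ∀ i ∈ s, 0 ≤ x i) :
    ∏ i ∈ s, x i ≤ (∑ i ∈ s, x i ^ s.card) / s.card := by
  have hn : s.card ≠ 0 := Finset.card_ne_zero.2 hs
  have hnpos : (0 : ℝ) < s.card := by exact_mod_cast Nat.pos_of_ne_zero hn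
  -- weighted AM–GM with weights `1/#s` applied to `x_i^{#s}`
  have h := Real.geom_mean_le_arith_mean_weighted s (fun _ => (s.card : ℝ)⁻¹) (fun i => x i ^ s.card)
    (fun _ _ => by positivity) (by rw [Finset.sum_const, nsmul_eq_mul, mul_inv_cancel₀ hnpos.ne'])
    (fun i hi => pow_nonneg (hx i hi) _)
  have hlhs : ∏ i ∈ s, (x i ^ s.card) ^ ((s.card : ℝ)⁻¹) = ∏ i ∈ s, x i :=
    Finset.prod_congr rfl fun i hi => Real.pow_rpow_inv_natCast (hx i hi) hn
  rw [hlhs] at h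
  calc ∏ i ∈ s, x i ≤ ∑ i ∈ s, (s.card : ℝ)⁻¹ * x i ^ s.card := h
    _ = (∑ i ∈ s, x i ^ s.card) / s.card := by rw [← Finset.mul_sum, inv_mul_eq_div]

/-! ## §2 The many-plaquette constant -/

variable {G : Type*} [Group G] [TopologicalSpace G] [IsTopologicalGroup G] [CompactSpace G]
  [MeasurableSpace G] [BorelSpace G]

/-- **A two-sided shift with optional inversion does not change `∫ wⁿ dHaar`**:
`∫ w(a h b)ⁿ dHaar(h) = ∫ w(a h⁻¹ b)ⁿ dHaar(h) = ∫ wⁿ dHaar`. [ours] -/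
theorem integral_shiftedWeight_pow_eq (w : G → ℝ) (a b : G) (ε : Bool) (n : ℕ) :
    ∫ h, w (a * (if ε then h else h⁻¹) * b) ^ n ∂(haarProbability G) = ∫ h, w h ^ n ∂(haarProbability G) := by
  cases ε with
  | true =>
    simp only [if_true]
    have h1 := integral_mul_left_eq_self (μ := haarProbability G) (fun h => w (h * b) ^ n) a
    have h2 := integral_mul_right_eq_self (μ := haarProbability G) (fun h => w h ^ n) b
    rw [h1, h2]
  | false =>
    simp only [Bool.false_eq_true, if_false]
    have h0 := integral_inv_eq_self (fun h => w (a * h * b) ^ n) (haarProbability G)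
    have h1 := integral_mul_left_eq_self (μ := haarProbability G) (fun h => w (h * b) ^ n) a
    have h2 := integral_mul_right_eq_self (μ := haarProbability G) (fun h => w h ^ n) b
    rw [← h2, ← h1, ← h0]

/-- **THE MANY-PLAQUETTE CONSTANT.**  `w ≥ 0` continuous on a compact group; a non-empty finite family of
shifts `h ↦ a_i h^{ε_i} b_i`.  Then `∫ ∏_{i∈s} w(a_i h^{ε_i} b_i) dHaar(h) ≤ ∫ w^{#s} dHaar` — pointwise AM–GM
and `integral_shiftedWeight_pow_eq` term by term. [ours] -/
theorem integral_prod_shiftedWeight_le {w : G → ℝ} (hw : Continuous w) (hw0 : ∀ g, 0 ≤ w g)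
    {ι : Type*} (s : Finset ι) (hs : s.Nonempty) (a b : ι → G) (ε : ι → Bool) :
    ∫ h, ∏ i ∈ s, w (a i * (if ε i then h else h⁻¹) * b i) ∂(haarProbability G) ≤
      ∫ h, w h ^ s.card ∂(haarProbability G) := by
  have hn : s.card ≠ 0 := Finset.card_ne_zero.2 hs
  have hnpos : (0 : ℝ) < s.card := by exact_mod_cast Nat.pos_of_ne_zero hn
  -- continuity / integrability of the pieces
  have hshift : ∀ i, Continuous fun h : G => w (a i * (if ε i then h else h⁻¹) * b i) := by
    intro i
    refine hw.comp ((continuous_const.mul ?_).mul continuous_const)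
    by_cases hε : ε i
    · simp only [hε, if_true]; exact continuous_id
    · simp only [hε]; exact continuous_inv
  have hprod : Integrable (fun h => ∏ i ∈ s, w (a i * (if ε i then h else h⁻¹) * b i)) (haarProbability G) :=
    Literature.Probability.LatticeModels.integrable_of_continuous_compactSpace _
      (continuous_finsetProd s fun i _ => hshift i)
  have hpow : ∀ i, Integrable (fun h => w (a i * (if ε i then h else h⁻¹) * b i) ^ s.card) (haarProbability G) :=
    fun i => Literature.Probability.LatticeModels.integrable_of_continuous_compactSpace _ ((hshift i).pow _)
  have hsum : Integrable (fun h => (∑ i ∈ s, w (a i * (if ε i then h else h⁻¹) * b i) ^ s.card) / s.card)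
      (haarProbability G) := (integrable_finsetSum s fun i _ => hpow i).div_const _
  -- pointwise AM–GM
  have hpt : ∀ h : G, ∏ i ∈ s, w (a i * (if ε i then h else h⁻¹) * b i) ≤
      (∑ i ∈ s, w (a i * (if ε i then h else h⁻¹) * b i) ^ s.card) / s.card := fun h =>
    prod_le_sum_pow_div_card s hs _ fun i _ => hw0 _
  refine (integral_mono hprod hsum hpt).trans_eq ?_
  rw [integral_div, integral_finsetSum s fun i _ => hpow i]
  simp only [integral_shiftedWeight_pow_eq]
  rw [Finset.sum_const, nsmul_eq_mul, mul_div_cancel_left₀ _ hnpos.ne']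

/-- The same with the normalised heat-bath form: `∫ ∏_{i∈s} w(a_i h^{ε_i} b_i) dHaar ≤ c·(c_{#s}/c)` where
`c = ∫ w`, `c_n = ∫ wⁿ` — the normaliser of the conditioner scoring all `#s` plaquettes closed by one link is at
most `c_{#s}`. [ours] -/
theorem integral_prod_shiftedWeight_le' {w : G → ℝ} (hw : Continuous w) (hw0 : ∀ g, 0 ≤ w g)
    (hc : ∫ g, w g ∂(haarProbability G) ≠ 0)
    {ι : Type*} (s : Finset ι) (hs : s.Nonempty) (a b : ι → G) (ε : ι → Bool) :
    ∫ h, ∏ i ∈ s, w (a i * (if ε i then h else h⁻¹) * b i) ∂(haarProbability G) ≤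
      (∫ g, w g ∂(haarProbability G)) *
        ((∫ h, w h ^ s.card ∂(haarProbability G)) / ∫ g, w g ∂(haarProbability G)) := by
  rw [mul_div_cancel₀ _ hc]
  exact integral_prod_shiftedWeight_le hw hw0 s hs a b ε

/-! ## §3 The constants `c_n = ∫ wⁿ dHaar` -/

/-- `c_{n+1} ≤ M·c_n` for `0 ≤ w ≤ M`. [ours] -/
theorem integral_pow_succ_le {w : G → ℝ} (hw : Continuous w) (hw0 : ∀ g, 0 ≤ w g) {M : ℝ}
    (hwM : ∀ g, w g ≤ M) (n : ℕ) :
    ∫ h, w h ^ (n + 1) ∂(haarProbability G) ≤ M * ∫ h, w h ^ n ∂(haarProbability G) := by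
  rw [← integral_const_mul]
  refine integral_mono
    (Literature.Probability.LatticeModels.integrable_of_continuous_compactSpace _ (hw.pow _))
    ((Literature.Probability.LatticeModels.integrable_of_continuous_compactSpace _ (hw.pow _)).const_mul M)
    fun h => ?_
  rw [pow_succ, mul_comm]
  exact mul_le_mul_of_nonneg_right (hwM h) (pow_nonneg (hw0 h) n)

/-- `c_n ≤ M^{n−1}·c_1` for `0 ≤ w ≤ M`, `n ≥ 1`. [ours] -/
theorem integral_pow_le {w : G → ℝ} (hw : Continuous w) (hw0 : ∀ g, 0 ≤ w g) {M : ℝ}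
    (hwM : ∀ g, w g ≤ M) (n : ℕ) :
    ∫ h, w h ^ (n + 1) ∂(haarProbability G) ≤ M ^ n * ∫ h, w h ∂(haarProbability G) := by
  induction n with
  | zero => simp
  | succ n ih =>
    have hM : 0 ≤ M := (hw0 1).trans (hwM 1)
    calc ∫ h, w h ^ (n + 1 + 1) ∂(haarProbability G) ≤ M * ∫ h, w h ^ (n + 1) ∂(haarProbability G) :=
          integral_pow_succ_le hw hw0 hwM (n + 1)
      _ ≤ M * (M ^ n * ∫ h, w h ∂(haarProbability G)) := mul_le_mul_of_nonneg_left ih hM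
      _ = M ^ (n + 1) * ∫ h, w h ∂(haarProbability G) := by ring

/-- **STRICTLY `c_n < M^{n−1}·c_1` for `n ≥ 2`** when `0 < w ≤ M` is continuous and NOT identically `M`
(`c_2 < M·c_1` is `PlaquetteTwoWeightConstant.integral_sq_div_integral_lt`; then `c_n ≤ M^{n−2} c_2`): scoring
`n ≥ 2` closing plaquettes with one draw beats the one-plaquette worst case by a definite factor. [ours] -/
theorem integral_pow_lt {w : G → ℝ} (hw : Continuous w) (hw0 : ∀ g, 0 < w g) {M : ℝ}
    (hwM : ∀ g, w g ≤ M) {g₀ : G} (hg₀ : w g₀ < M) (n : ℕ) :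
    ∫ h, w h ^ (n + 2) ∂(haarProbability G) < M ^ (n + 1) * ∫ h, w h ∂(haarProbability G) := by
  have hc : 0 < ∫ h, w h ∂(haarProbability G) := haarProbability_integral_pos_of_continuous_pos hw hw0
  have hM : 0 < M := (hw0 1).trans_le (hwM 1)
  have h2 : ∫ h, w h ^ 2 ∂(haarProbability G) < M * ∫ h, w h ∂(haarProbability G) := by
    have h := integral_sq_div_integral_lt hw hw0 hwM hg₀
    rwa [div_lt_iff₀ hc] at h
  induction n with
  | zero => simpa using h2
  | succ n ih =>
    calc ∫ h, w h ^ (n + 1 + 2) ∂(haarProbability G) ≤ M * ∫ h, w h ^ (n + 2) ∂(haarProbability G) :=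
          integral_pow_succ_le hw (fun g => (hw0 g).le) hwM (n + 2)
      _ < M * (M ^ (n + 1) * ∫ h, w h ∂(haarProbability G)) := mul_lt_mul_of_pos_left ih hM
      _ = M ^ (n + 1 + 1) * ∫ h, w h ∂(haarProbability G) := by ring

/-- **The ratios `θ_n := c_{n+1}/(c·Mⁿ)` decrease in `n`**: `θ_{n+1} ≤ θ_n` (`c_{n+2} ≤ M·c_{n+1}`; `0 < w ≤ M`).
[ours] -/
theorem integral_pow_ratio_succ_le {w : G → ℝ} (hw : Continuous w) (hw0 : ∀ g, 0 < w g) {M : ℝ}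
    (hwM : ∀ g, w g ≤ M) (n : ℕ) :
    (∫ h, w h ^ (n + 2) ∂(haarProbability G)) / ((∫ g, w g ∂(haarProbability G)) * M ^ (n + 1)) ≤
      (∫ h, w h ^ (n + 1) ∂(haarProbability G)) / ((∫ g, w g ∂(haarProbability G)) * M ^ n) := by
  have hc : 0 < ∫ g, w g ∂(haarProbability G) := haarProbability_integral_pos_of_continuous_pos hw hw0
  have hM : 0 < M := (hw0 1).trans_le (hwM 1)
  rw [div_le_div_iff₀ (mul_pos hc (pow_pos hM _)) (mul_pos hc (pow_pos hM _))]
  have h := integral_pow_succ_le hw (fun g => (hw0 g).le) hwM (n + 1)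
  have hc0 : 0 ≤ (∫ g, w g ∂(haarProbability G)) * M ^ n := (mul_pos hc (pow_pos hM _)).le
  calc (∫ h, w h ^ (n + 2) ∂(haarProbability G)) * ((∫ g, w g ∂(haarProbability G)) * M ^ n)
      ≤ (M * ∫ h, w h ^ (n + 1) ∂(haarProbability G)) * ((∫ g, w g ∂(haarProbability G)) * M ^ n) :=
        mul_le_mul_of_nonneg_right h hc0
    _ = (∫ h, w h ^ (n + 1) ∂(haarProbability G)) * ((∫ g, w g ∂(haarProbability G)) * M ^ (n + 1)) := by
        ring

/-- **Hence every `θ_n` (`n ≥ 1`) is at most the Cauchy–Schwarz two-plaquette ratio `θ_1 = c_2/(c·M)`** of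
`PlaquetteTwoWeightConstant` §5: bounds through the many-plaquette constants are never worse than through the
two-plaquette constant. [ours] -/
theorem integral_pow_ratio_le_two {w : G → ℝ} (hw : Continuous w) (hw0 : ∀ g, 0 < w g) {M : ℝ}
    (hwM : ∀ g, w g ≤ M) (n : ℕ) :
    (∫ h, w h ^ (n + 2) ∂(haarProbability G)) / ((∫ g, w g ∂(haarProbability G)) * M ^ (n + 1)) ≤
      (∫ h, w h ^ 2 ∂(haarProbability G)) / ((∫ g, w g ∂(haarProbability G)) * M ^ 1) := by
  induction n with
  | zero => exact le_rfl
  | succ n ih => exact (integral_pow_ratio_succ_le hw hw0 hwM (n + 1)).trans ih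

end Summit.Ventures.LatticeQCDFlow.Theory2.Autoregressive
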